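import Literature.MathematicalPhysics.QuantumFieldTheory.Balaban1983to89.B1Eq324BenfattoSect5UpperAssembly
import Literature.MathematicalPhysics.QuantumFieldTheory.Balaban1983to89.B1Eq324BenfattoEq324Signed
import HarnessLib

/-!
# Benfatto et al. 1978, §5 — THE KNIT of the Basic Lemma p. 152: (4.6) ∧ (4.7) with recorded signs from ONE ledger socket

doc: Literature/MathematicalPhysics/QuantumFieldTheory/Balaban1983to89/B1Eq324BenfattoLemma.md

This module closes the §5 assembly of [BenfattoEtAl1978] down to the «pure real analysis on the ledger» (p. 159 «Collecting all the errors made in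
this process (4.7) is proven»; «b* can be chosen = max{10⁴, γ⁻³b̄}»).  The two printed inequalities are already kernel-reduced to ONE closed real
inequality each — (4.7) = `…Sect5LowerAssembly.ineq47_of_ledger`, (4.6) = `…Sect5UpperAssembly.ineq46_of_ledger` — for FREE pavement parameters
`L, w, v`, contraction `γ`, rate `δ`, Appendix-A triple `(b̄, k₁, k₂)` and constants `S, ρ₁, ρ₂, ρ₃, ρ₄`.  Here the quantifier bookkeeping of the Lemma
is done once and for all: from ONE hypothesis `hboth` — THE LEDGER SOCKET, stating that for every Appendix-A triple with `k₁ ≥ 0 < k₂` there is a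
free-field threshold `b*` (chosen BEFORE `t, D, ϰ`) beyond which, for every `t, D, ϰ`, common exponents `ρ₁ … ρ₄` (`ρ₃ > 0`) and, separately for the
lower and the upper side, a constant `S ≥ 0`, a rate `δ` and `b`-dependent parameters `L, w, v` satisfy every side condition of the two assembly theorems
and the two closed ledger inequalities (the l.h.s. of `ineq47_of_ledger` / `ineq46_of_ledger`'s `hledger` VERBATIM with `|I|` replaced by a real `nI ≥ 1`
and `A = sup|coeff|` by a real `A ≥ 0`, uniformly in `s`) — the Lemma p. 152 follows in the SIGNED SHAPE of `…B1Eq324BenfattoEq324Signed`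
(`0 ≤ S ∧ 0 < ρ₃` recorded), hence `BasicLemma d α β` (`basicLemma_of_signed`) and B1 (3.24) (`eq324_of_basicLemma_signed`).  The knit takes
`S := max S₄₇ S₄₆` (`…ErrTermLedger.errTerm_mono`), the far-conditioning radius `R := b³` (print: «C at distance b³ from J»), and the Appendix-A triple
EXPLICITLY `(b̄, k₁, k₂) = (2, 4·8^d, ½)` (`appendixA_at_two`, from `…AppendixA.appendixA_explicit` at `C = 1`).  The socket itself — elementary real
analysis with print's `L = ⌈b²⌉`, `v = ⌈Mb^{3/2}⌉`, `w = 2v` above a `(t,D,ϰ)`-dependent `b₀` and narrow corridors below it — is discharged in the sibling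
modules `…Sect5LedgerDischarge*` (seat `dag-n08-b`); it is a HYPOTHESIS here, nothing is asserted.
[cite: BenfattoEtAl1978, Basic Lemma (4.5)–(4.7) p.152, Remark 1; §5 pp.153–159; b* p.159; Appendix A p.161]

## Theorems
* `appendixA_at_two` — Appendix A with the explicit triple `b̄ = 2`, `k₁ = 4·8^d`, `k₂ = ½` for any free field with `E z_Δ² ≤ 1`.
* ★ `basicLemma_signed_of_ledgers` — the Lemma p. 152 in the signed shape from the ledger socket.

HONEST SCOPE.  Quantifier bookkeeping only (two assembly theorems applied by name); the socket `hboth` is displayed, not proved; count-neutral for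
N08; nothing of [Balaban1985UV3] (41)/(47)/(5) is asserted; nothing about d = 4, the continuum, OS axioms, a mass gap or the Clay problem.
-/

namespace Literature.MathematicalPhysics.QuantumFieldTheory.Balaban1983to89.B1Eq324BenfattoSect5BasicLemmaKnit

open MeasureTheory ProbabilityTheory Finset
open scoped BigOperators Nat
open Literature.Probability.LatticeModels (setPartitions)
open Literature.MathematicalPhysics.QuantumFieldTheory
open Literature.MathematicalPhysics.QuantumFieldTheory.Balaban1983to89.B1Eq324BenfattoLemma
open Literature.MathematicalPhysics.QuantumFieldTheory.Balaban1983to89.B1Eq324BenfattoSect5Eq511 (s1Const)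
open Literature.MathematicalPhysics.QuantumFieldTheory.Balaban1983to89.B1Eq324GaussianMomentLeaf (momentConst)
open Literature.MathematicalPhysics.QuantumFieldTheory.Balaban1983to89.B1Eq324BenfattoSpecialisation (coefSup_nonneg)
open Literature.MathematicalPhysics.QuantumFieldTheory.Balaban1983to89.B1Eq324BenfattoSect5ErrTermLedger (errTerm_mono)
open Literature.MathematicalPhysics.QuantumFieldTheory.Balaban1983to89.B1Eq324BenfattoAppendixA (appendixA_explicit)
open Literature.MathematicalPhysics.QuantumFieldTheory.Balaban1983to89.B1Eq324BenfattoSect5LowerAssembly (ineq47_of_ledger)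
open Literature.MathematicalPhysics.QuantumFieldTheory.Balaban1983to89.B1Eq324BenfattoSect5UpperAssembly (ineq46_of_ledger)

variable {d : ℕ} {α β : ℝ}

/-- **Appendix A with explicit constants**: for the free field `(d, α, β)` with `E z_Δ² = G(0,0) ≤ 1`, every cut-off `c > 2` and every nonempty
region `I'`, `P̂₀(Π_Δ χ̂ᶜ_Δ) ≥ exp(−|I'|·4·8^d·e^{−c²/2})` — the triple `(b̄, k₁, k₂) = (2, 4·8^d, ½)` of `AppendixALemma`, in the binder shape of
`…Sect5LowerAssembly.ineq47_of_ledger`'s `hAppA` (`appendixA_explicit` at `C = 1`). [cite: BenfattoEtAl1978, Appendix A (A.1)–(A.2), (A.6) p.161] -/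
theorem appendixA_at_two (hα : 0 < α) (hβ : 0 < β) (hvar : freeCov d α β 0 0 ≤ 1) :
    ∀ c : ℝ, 2 < c → ∀ I' : Finset (B1Eq324BenfattoLemma.Site d), I'.Nonempty →
      Real.exp (-((I'.card : ℝ) * (4 * 8 ^ d * Real.exp (-(1 / 2 * c ^ 2))))) ≤ (P0 d α β).real (smallFieldSet I' c) := by
  intro c hc I' hI'
  have hc0 : 0 < c := by linarith
  have h4 : 4 * (1 : ℝ) ≤ c ^ 2 := by nlinarith
  have h := appendixA_explicit hα hβ (C := 1) one_pos hvar hc0 h4 hI'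
  have heq : (1 / 2 : ℝ) * c ^ 2 = c ^ 2 / (2 * 1) := by ring
  rw [heq]
  exact h

section Knit

set_option maxHeartbeats 800000 in -- the ledger socket is a very large term (two copies of the assembly theorems' closed hypotheses)
/-- ★ **THE KNIT — the Lemma p. 152 of [BenfattoEtAl1978] WITH RECORDED SIGNS from the LEDGER SOCKET.**  For `d ≥ 1`, `α, β > 0` with
`E z_Δ² ≤ ½`, a contraction `0 < γ ≤ 1` with `γ(1 + 2d/α²) ≤ ½`, assume the socket `hboth`: for every Appendix-A triple `(b̄, k₁, k₂)` with
`k₁ ≥ 0`, `k₂ > 0` there is a threshold `b*` such that for all `t, D` and `ϰ > 0` there are COMMON exponents `ρ₁, ρ₂, ρ₃ > 0, ρ₄` and, for the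
LOWER side, `S ≥ 0` and a rate `0 < δ ≤ log((2d+α²)/2d)` with `δD²√d < ϰ` such that every `b > b*` admits pavement parameters `L, w, v` with
`2(2w+v) < L`, `(d+1)·2(2w+v) ≤ L`, `v ≤ w`, `1 ≤ w`, `1 ≤ γ^{d+1}b`, `L^d e^{−(γ^d b)²/4} ≤ 1/6`, `b̄ < γ^{d+1}b` and the closed lower ledger
(`ineq47_of_ledger`'s `hledger` with `|I| ↦ nI`) for all `s`, `nI ≥ 1`, `A ≥ 0`; and, for the UPPER side, the same with `1 ≤ b`, `L^d e^{−b²/4} ≤ 1/6`,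
`√d(L−1) < b³` and the closed upper ledger (`ineq46_of_ledger`'s `hledger` with `|I| ↦ nI`).  THEN: `∃ b*, ∀ t D ϰ > 0, ∃ S ρ₁ ρ₂ ρ₃ ρ₄, 0 ≤ S ∧ 0 < ρ₃ ∧
∀ s, ∀ b > b*, ∀ I ⊇ J, I ≠ ∅, ∀ a, (∀ C z̄, (∀ x ∈ C, ∀ y ∈ J, b³ ≤ d(Δ_x,Δ_y)) → (4.6)) ∧ (4.7)`.  Proof: the socket at `(b̄, k₁, k₂) := (2, 4·8^d, ½)`
(`appendixA_at_two`); `S := max S₄₇ S₄₆` by `errTerm_mono`; (4.6) = `ineq46_of_ledger` at `R := b³`, (4.7) = `ineq47_of_ledger`, each fed its own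
`(L, w, v, δ)` and the socket's inequality at `nI := |I|`, `A := sup|coeff|`.
[cite: BenfattoEtAl1978, Basic Lemma (4.5)–(4.7) p.152; §5 pp.153–159 «Collecting all the errors»; b* = max{10⁴, γ⁻³b̄} p.159; Appendix A p.161] -/
theorem basicLemma_signed_of_ledgers (hα : 0 < α) (hβ : 0 < β) (hvar : freeCov d α β 0 0 ≤ 1 / 2) (hd : 0 < d)
    {γ : ℝ} (hγ0 : 0 < γ) (hγ1 : γ ≤ 1) (hγc : γ * (1 + 2 * d / α ^ 2) ≤ 1 / 2)
    (hboth : ∀ (bbar k₁ k₂ : ℝ), 0 ≤ k₁ → 0 < k₂ → ∃ bstar : ℝ, ∀ (t D : ℕ) (κ : ℝ), 0 < κ →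
      ∃ ρ₁ ρ₂ ρ₃ ρ₄ : ℝ, 0 < ρ₃ ∧
        (∃ S δ : ℝ, 0 ≤ S ∧ 0 < δ ∧ δ ≤ Real.log ((2 * d + α ^ 2) / (2 * d)) ∧ 0 < κ / 2 - δ / 2 * ((D : ℝ) ^ 2 * Real.sqrt d) ∧
          ∀ b : ℝ, bstar < b → ∃ L w v : ℕ, 2 * (2 * w + v) < L ∧ (d + 1) * (2 * (2 * w + v)) ≤ L ∧ v ≤ w ∧ 1 ≤ w ∧
            1 ≤ γ ^ (d + 1) * b ∧ ((L : ℝ) ^ d) * Real.exp (-((γ ^ d * b) ^ 2 / 4)) ≤ 1 / 6 ∧ bbar < γ ^ (d + 1) * b ∧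
            ∀ (s : ℕ) (nI A : ℝ), 1 ≤ nI → 0 ≤ A →
              ∑ n ∈ Finset.range (d + 1),
                  (((s1Const s D d κ * A * (γ ^ n * b) ^ D * Real.exp (-(κ / 4 * w)) * nI
                    + s1Const s D d κ * A * (γ ^ n * b) ^ D *
                      (Real.exp (-(κ / 4 * w)) * (nI * (L : ℝ) ^ d) + Real.exp (-(κ / 4 * v)) * (nI * (L : ℝ) ^ d))) : ℝ)
                    + (nI * ((let M : ℝ := A * (L : ℝ) ^ d * ∑ p ∈ Finset.Icc 1 s, ((admissible p D).card : ℝ) *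
                      ((2 / (1 - Real.exp (-(κ / 2 / (p : ℕ) / Real.sqrt d))) * Real.exp (κ / 2 / (p : ℕ) / Real.sqrt d)) ^ d) ^ (p - 1)
                  let Mt : ℝ := A * Real.exp (δ / 2 * ((D : ℝ) ^ 2 * d)) * (L : ℝ) ^ d * ∑ p ∈ Finset.Icc 1 s, ((admissible p D).card : ℝ) *
                      ((2 / (1 - Real.exp (-((κ / 2 - δ / 2 * ((D : ℝ) ^ 2 * Real.sqrt d)) / (p : ℕ) / Real.sqrt d))) *
                        Real.exp ((κ / 2 - δ / 2 * ((D : ℝ) ^ 2 * Real.sqrt d)) / (p : ℕ) / Real.sqrt d)) ^ d) ^ (p - 1)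
                  let K : ℝ := 4 * (s1Const s D d κ * A * (γ ^ n * b) ^ D * (L : ℝ) ^ d)
                  let ε : ℝ := s1Const s D d κ * A * (γ ^ n * b) ^ D * Real.exp (-(κ / 4 * v)) * (L : ℝ) ^ d
                  let W : ℝ := 3 * (((L : ℝ) ^ d) * Real.exp (-((γ ^ n * b) ^ 2 / 4)))
                  let cχ : ℕ → ℝ := fun k => 2 ^ k * ((∑ π ∈ setPartitions (univ : Finset (Fin k)), ((π.card - 1)! : ℝ)) *
                      ((min 1 (2 * ((L : ℝ) ^ d) * Real.exp (-((γ ^ n * b) ^ 2 / 4)))) ^ ((2 * k : ℕ) : ℝ)⁻¹ *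
                        ((1 + (1 + 2 * d / α ^ 2) * (γ * (γ ^ n * b))) ^ D * M * momentConst D (2 * k) (freeCov d α β 0 0).toNNReal) ^ k))
                  let K₀ : ℝ := max (max 1 (freeCov d α β 0 0)) ((1 + 2 * d / α ^ 2) * (γ * (γ ^ n * b)))
                  let ε₃₁ : ℝ := max (β * (2 * d * (freeCov d α β 0 0 * (2 * d / (2 * d + α ^ 2)) ^ (w - v))) *
                        (γ * (γ ^ n * b) * ((L : ℝ) ^ d * (1 + Real.sqrt d * ((L : ℝ) - 1)))))
                      (2 * d * freeCov d α β 0 0 * (2 * d / (2 * d + α ^ 2)) ^ (w - v) / α ^ 2)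
                  let δ₂₉ : ℕ → ℝ := fun k => 2 ^ (k * D) * 2 ^ 2 ^ (k * D) * K₀ ^ (k * D) * Real.exp (-(δ / 2 * ((v : ℝ) + 1))) * Mt ^ k
                  let δ₃₁ : ℕ → ℝ := fun k => M ^ k * (2 ^ (k * D) * 2 ^ 2 ^ (k * D) * ((k * D : ℕ) * K₀ ^ (k * D) * ε₃₁))
                  let Err : ℝ := 2 * (2 ^ ((t + 1).choose 2) * K ^ (t + 1) / (t + 1)!) + Real.exp (2 * K) * W
                      + ∑ k ∈ Finset.range t,
                          (3 ^ (k + 1) * ((∑ π ∈ setPartitions (univ : Finset (Fin (k + 1))), ((π.card - 1)! : ℝ)) * (ε * K ^ k))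
                            + 3 ^ (k + 1) * (cχ (k + 1) + δ₂₉ (k + 1)) + 3 ^ (k + 1) * (cχ (k + 1) + δ₃₁ (k + 1))) / (k + 1)!
                  Err) : ℝ)
                    + (            ∑ k ∈ Finset.range t,
                    ((2 ^ (k + 1) * (2 ^ ((k + 1) * D) * 2 ^ 2 ^ ((k + 1) * D) * (max 1 (freeCov d α β 0 0)) ^ ((k + 1) * D)) *
                    ((A * Real.exp (δ / 2 * ((D : ℝ) ^ 2 * d)) *
                        Real.exp (-((κ / 2 - δ / 2 * ((D : ℝ) ^ 2 * Real.sqrt d)) / 2 * w))) * nI *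
                      ∑ p ∈ Finset.Icc 1 s, ((admissible p D).card : ℝ) *
                        ((2 / (1 - Real.exp (-((κ / 2 - δ / 2 * ((D : ℝ) ^ 2 * Real.sqrt d)) / 2 / (p : ℕ) / Real.sqrt d))) *
                          Real.exp ((κ / 2 - δ / 2 * ((D : ℝ) ^ 2 * Real.sqrt d)) / 2 / (p : ℕ) / Real.sqrt d)) ^ d) ^ (p - 1)) *
                    (A * Real.exp (δ / 2 * ((D : ℝ) ^ 2 * d)) *
                      ((1 : ℝ) * (2 / (1 - Real.exp (-(δ / (2 * ((k + 1 : ℕ) : ℝ)) / Real.sqrt d))) * Real.exp (δ / (2 * ((k + 1 : ℕ) : ℝ)) / Real.sqrt d)) ^ d) *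
                      ∑ p ∈ Finset.Icc 1 s, ((admissible p D).card : ℝ) *
                        ((2 / (1 - Real.exp (-((κ / 2 - δ / 2 * ((D : ℝ) ^ 2 * Real.sqrt d)) / (p : ℕ) / Real.sqrt d))) *
                          Real.exp ((κ / 2 - δ / 2 * ((D : ℝ) ^ 2 * Real.sqrt d)) / (p : ℕ) / Real.sqrt d)) ^ d) ^ (p - 1)) ^ k
                    + 2 ^ (k + 1) * (2 ^ ((k + 1) * D) * 2 ^ 2 ^ ((k + 1) * D) * (max 1 (freeCov d α β 0 0)) ^ ((k + 1) * D)) *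
                  (nI * (A * Real.exp (δ / 2 * ((D : ℝ) ^ 2 * d)) * Real.exp (-((κ / 2 - δ / 2 * ((D : ℝ) ^ 2 * Real.sqrt d)) / 2 * v)) *
                    (L : ℝ) ^ d * ∑ p ∈ Finset.Icc 1 s, ((admissible p D).card : ℝ) *
                        ((2 / (1 - Real.exp (-((κ / 2 - δ / 2 * ((D : ℝ) ^ 2 * Real.sqrt d)) / 2 / (p : ℕ) / Real.sqrt d))) *
                          Real.exp ((κ / 2 - δ / 2 * ((D : ℝ) ^ 2 * Real.sqrt d)) / 2 / (p : ℕ) / Real.sqrt d)) ^ d) ^ (p - 1))) *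
                  (A * Real.exp (δ / 2 * ((D : ℝ) ^ 2 * d)) *
                    (2 / (1 - Real.exp (-(δ / (2 * ((k + 1 : ℕ) : ℝ)) / Real.sqrt d))) * Real.exp (δ / (2 * ((k + 1 : ℕ) : ℝ)) / Real.sqrt d)) ^ d *
                    ∑ p ∈ Finset.Icc 1 s, ((admissible p D).card : ℝ) *
                        ((2 / (1 - Real.exp (-((κ / 2 - δ / 2 * ((D : ℝ) ^ 2 * Real.sqrt d)) / (p : ℕ) / Real.sqrt d))) *
                          Real.exp ((κ / 2 - δ / 2 * ((D : ℝ) ^ 2 * Real.sqrt d)) / (p : ℕ) / Real.sqrt d)) ^ d) ^ (p - 1)) ^ k)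
                    + (2 ^ (k + 1) * (2 ^ ((k + 1) * D) * 2 ^ 2 ^ ((k + 1) * D) * (max 1 (freeCov d α β 0 0)) ^ ((k + 1) * D)) *
                    (A * Real.exp (δ / 2 * ((D : ℝ) ^ 2 * d)) * Real.exp (-((κ / 2 - δ / 2 * ((D : ℝ) ^ 2 * Real.sqrt d)) / 2 * w)) *
                      (nI * (L : ℝ) ^ d) * ∑ p ∈ Finset.Icc 1 s, ((admissible p D).card : ℝ) *
                        ((2 / (1 - Real.exp (-((κ / 2 - δ / 2 * ((D : ℝ) ^ 2 * Real.sqrt d)) / 2 / (p : ℕ) / Real.sqrt d))) *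
                          Real.exp ((κ / 2 - δ / 2 * ((D : ℝ) ^ 2 * Real.sqrt d)) / 2 / (p : ℕ) / Real.sqrt d)) ^ d) ^ (p - 1)) *
                    (A * Real.exp (δ / 2 * ((D : ℝ) ^ 2 * d)) *
                      (2 / (1 - Real.exp (-(δ / (2 * ((k + 1 : ℕ) : ℝ)) / Real.sqrt d))) * Real.exp (δ / (2 * ((k + 1 : ℕ) : ℝ)) / Real.sqrt d)) ^ d *
                      ∑ p ∈ Finset.Icc 1 s, ((admissible p D).card : ℝ) *
                        ((2 / (1 - Real.exp (-((κ / 2 - δ / 2 * ((D : ℝ) ^ 2 * Real.sqrt d)) / (p : ℕ) / Real.sqrt d))) *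
                          Real.exp ((κ / 2 - δ / 2 * ((D : ℝ) ^ 2 * Real.sqrt d)) / (p : ℕ) / Real.sqrt d)) ^ d) ^ (p - 1)) ^ k
                    + 2 ^ (k + 1) * (2 ^ ((k + 1) * D) * 2 ^ 2 ^ ((k + 1) * D) * (max 1 (freeCov d α β 0 0)) ^ ((k + 1) * D)) *
                  (nI * (A * Real.exp (δ / 2 * ((D : ℝ) ^ 2 * d)) * Real.exp (-((κ / 2 - δ / 2 * ((D : ℝ) ^ 2 * Real.sqrt d)) / 2 * v)) *
                    (L : ℝ) ^ d * ∑ p ∈ Finset.Icc 1 s, ((admissible p D).card : ℝ) *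
                        ((2 / (1 - Real.exp (-((κ / 2 - δ / 2 * ((D : ℝ) ^ 2 * Real.sqrt d)) / 2 / (p : ℕ) / Real.sqrt d))) *
                          Real.exp ((κ / 2 - δ / 2 * ((D : ℝ) ^ 2 * Real.sqrt d)) / 2 / (p : ℕ) / Real.sqrt d)) ^ d) ^ (p - 1))) *
                  (A * Real.exp (δ / 2 * ((D : ℝ) ^ 2 * d)) *
                    (2 / (1 - Real.exp (-(δ / (2 * ((k + 1 : ℕ) : ℝ)) / Real.sqrt d))) * Real.exp (δ / (2 * ((k + 1 : ℕ) : ℝ)) / Real.sqrt d)) ^ d *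
                    ∑ p ∈ Finset.Icc 1 s, ((admissible p D).card : ℝ) *
                        ((2 / (1 - Real.exp (-((κ / 2 - δ / 2 * ((D : ℝ) ^ 2 * Real.sqrt d)) / (p : ℕ) / Real.sqrt d))) *
                          Real.exp ((κ / 2 - δ / 2 * ((D : ℝ) ^ 2 * Real.sqrt d)) / (p : ℕ) / Real.sqrt d)) ^ d) ^ (p - 1)) ^ k)
                    + 2 ^ ((k + 1) * D) * 2 ^ 2 ^ ((k + 1) * D) * (max 1 (freeCov d α β 0 0)) ^ ((k + 1) * D) *
                  (nI * (((k + 1 : ℕ) : ℝ) * (k : ℝ) *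
                    ((A * Real.exp (δ / 2 * ((D : ℝ) ^ 2 * d)) * ((L : ℝ) ^ d * (2 / (1 - Real.exp (-(δ / (2 * ((k + 1 : ℕ) : ℝ)) / Real.sqrt d))) * Real.exp (δ / (2 * ((k + 1 : ℕ) : ℝ)) / Real.sqrt d)) ^ d) *
                        ∑ p ∈ Finset.Icc 1 s, ((admissible p D).card : ℝ) *
                        ((2 / (1 - Real.exp (-((κ / 2 - δ / 2 * ((D : ℝ) ^ 2 * Real.sqrt d)) / (p : ℕ) / Real.sqrt d))) *
                          Real.exp ((κ / 2 - δ / 2 * ((D : ℝ) ^ 2 * Real.sqrt d)) / (p : ℕ) / Real.sqrt d)) ^ d) ^ (p - 1)) * ((A * Real.exp (δ / 2 * ((D : ℝ) ^ 2 * d)) * Real.exp (-(δ / (2 * ((k + 1 : ℕ) : ℝ)) / 2 * ((w : ℝ) + v + 1))) * ((L : ℝ) ^ d * (2 / (1 - Real.exp (-(δ / (2 * ((k + 1 : ℕ) : ℝ)) / 2 / Real.sqrt d))) * Real.exp (δ / (2 * ((k + 1 : ℕ) : ℝ)) / 2 / Real.sqrt d)) ^ d) *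
                        ∑ p ∈ Finset.Icc 1 s, ((admissible p D).card : ℝ) *
                        ((2 / (1 - Real.exp (-((κ / 2 - δ / 2 * ((D : ℝ) ^ 2 * Real.sqrt d)) / (p : ℕ) / Real.sqrt d))) *
                          Real.exp ((κ / 2 - δ / 2 * ((D : ℝ) ^ 2 * Real.sqrt d)) / (p : ℕ) / Real.sqrt d)) ^ d) ^ (p - 1)) *
                       (A * Real.exp (δ / 2 * ((D : ℝ) ^ 2 * d)) * ((L : ℝ) ^ d * (2 / (1 - Real.exp (-(δ / (2 * ((k + 1 : ℕ) : ℝ)) / Real.sqrt d))) * Real.exp (δ / (2 * ((k + 1 : ℕ) : ℝ)) / Real.sqrt d)) ^ d) *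
                        ∑ p ∈ Finset.Icc 1 s, ((admissible p D).card : ℝ) *
                        ((2 / (1 - Real.exp (-((κ / 2 - δ / 2 * ((D : ℝ) ^ 2 * Real.sqrt d)) / (p : ℕ) / Real.sqrt d))) *
                          Real.exp ((κ / 2 - δ / 2 * ((D : ℝ) ^ 2 * Real.sqrt d)) / (p : ℕ) / Real.sqrt d)) ^ d) ^ (p - 1)) ^ (k - 1)))))
                    + nI * ((3 : ℝ) ^ (k + 1) *
                  (2 ^ ((k + 1) * D) * 2 ^ 2 ^ ((k + 1) * D) * (max 1 (freeCov d α β 0 0)) ^ ((k + 1) * D) *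
                      Real.exp (-(δ / 2 * ((v : ℝ) + 1))) *
                    (A * Real.exp (δ / 2 * ((D : ℝ) ^ 2 * d)) * (L : ℝ) ^ d * ∑ p ∈ Finset.Icc 1 s, ((admissible p D).card : ℝ) *
                        ((2 / (1 - Real.exp (-((κ / 2 - δ / 2 * ((D : ℝ) ^ 2 * Real.sqrt d)) / (p : ℕ) / Real.sqrt d))) *
                          Real.exp ((κ / 2 - δ / 2 * ((D : ℝ) ^ 2 * Real.sqrt d)) / (p : ℕ) / Real.sqrt d)) ^ d) ^ (p - 1)) ^ (k + 1)))) / (k + 1)! : ℝ)))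
                  + nI * (k₁ * Real.exp (-(k₂ * (γ ^ (d + 1) * b) ^ 2)))
                ≤ nI * errTerm S ρ₁ ρ₂ ρ₃ ρ₄ A b t) ∧
        (∃ S δ : ℝ, 0 ≤ S ∧ 0 < δ ∧ δ ≤ Real.log ((2 * d + α ^ 2) / (2 * d)) ∧ 0 < κ / 2 - δ / 2 * ((D : ℝ) ^ 2 * Real.sqrt d) ∧
          ∀ b : ℝ, bstar < b → ∃ L w v : ℕ, 2 * (2 * w + v) < L ∧ (d + 1) * (2 * (2 * w + v)) ≤ L ∧ v ≤ w ∧ 1 ≤ w ∧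
            1 ≤ b ∧ ((L : ℝ) ^ d) * Real.exp (-(b ^ 2 / 4)) ≤ 1 / 6 ∧ Real.sqrt d * ((L : ℝ) - 1) < b ^ 3 ∧
            ∀ (s : ℕ) (nI A : ℝ), 1 ≤ nI → 0 ≤ A →
              ∑ n ∈ Finset.range (d + 1),
                  (((s1Const s D d κ * A * (γ * (b / γ ^ (n + 1))) ^ D * Real.exp (-(κ / 4 * w)) * nI
                    + s1Const s D d κ * A * (b / γ ^ (n + 1)) ^ D *
                      (Real.exp (-(κ / 4 * w)) * (nI * (L : ℝ) ^ d) + Real.exp (-(κ / 4 * v)) * (nI * (L : ℝ) ^ d))) : ℝ)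
                    + (nI * ((let M : ℝ := A * (L : ℝ) ^ d * ∑ p ∈ Finset.Icc 1 s, ((admissible p D).card : ℝ) *
                      ((2 / (1 - Real.exp (-(κ / 2 / (p : ℕ) / Real.sqrt d))) * Real.exp (κ / 2 / (p : ℕ) / Real.sqrt d)) ^ d) ^ (p - 1)
                  let Mt : ℝ := A * Real.exp (δ / 2 * ((D : ℝ) ^ 2 * d)) * (L : ℝ) ^ d * ∑ p ∈ Finset.Icc 1 s, ((admissible p D).card : ℝ) *
                      ((2 / (1 - Real.exp (-((κ / 2 - δ / 2 * ((D : ℝ) ^ 2 * Real.sqrt d)) / (p : ℕ) / Real.sqrt d))) *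
                        Real.exp ((κ / 2 - δ / 2 * ((D : ℝ) ^ 2 * Real.sqrt d)) / (p : ℕ) / Real.sqrt d)) ^ d) ^ (p - 1)
                  let K : ℝ := 4 * (s1Const s D d κ * A * (b / γ ^ (n + 1)) ^ D * (L : ℝ) ^ d)
                  let ε : ℝ := s1Const s D d κ * A * (b / γ ^ (n + 1)) ^ D * Real.exp (-(κ / 4 * v)) * (L : ℝ) ^ d
                  let W : ℝ := 3 * (((L : ℝ) ^ d) * Real.exp (-((b / γ ^ (n + 1)) ^ 2 / 4)))
                  let cχ : ℕ → ℝ := fun k => 2 ^ k * ((∑ π ∈ setPartitions (univ : Finset (Fin k)), ((π.card - 1)! : ℝ)) *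
                      ((min 1 (2 * ((L : ℝ) ^ d) * Real.exp (-((b / γ ^ (n + 1)) ^ 2 / 4)))) ^ ((2 * k : ℕ) : ℝ)⁻¹ *
                        ((1 + (1 + 2 * d / α ^ 2) * (γ * (b / γ ^ (n + 1)))) ^ D * M * momentConst D (2 * k) (freeCov d α β 0 0).toNNReal) ^ k))
                  let K₀ : ℝ := max (max 1 (freeCov d α β 0 0)) ((1 + 2 * d / α ^ 2) * (γ * (b / γ ^ (n + 1))))
                  let ε₃₁ : ℝ := max (β * (2 * d * (freeCov d α β 0 0 * (2 * d / (2 * d + α ^ 2)) ^ (w - v))) *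
                        (γ * (b / γ ^ (n + 1)) * ((L : ℝ) ^ d * (1 + Real.sqrt d * ((L : ℝ) - 1)))))
                      (2 * d * freeCov d α β 0 0 * (2 * d / (2 * d + α ^ 2)) ^ (w - v) / α ^ 2)
                  let δ₂₉ : ℕ → ℝ := fun k => 2 ^ (k * D) * 2 ^ 2 ^ (k * D) * K₀ ^ (k * D) * Real.exp (-(δ / 2 * ((v : ℝ) + 1))) * Mt ^ k
                  let δ₃₁ : ℕ → ℝ := fun k => M ^ k * (2 ^ (k * D) * 2 ^ 2 ^ (k * D) * ((k * D : ℕ) * K₀ ^ (k * D) * ε₃₁))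
                  let Err : ℝ := 2 * (2 ^ ((t + 1).choose 2) * K ^ (t + 1) / (t + 1)!) + Real.exp (2 * K) * W
                      + ∑ k ∈ Finset.range t,
                          (3 ^ (k + 1) * ((∑ π ∈ setPartitions (univ : Finset (Fin (k + 1))), ((π.card - 1)! : ℝ)) * (ε * K ^ k))
                            + 3 ^ (k + 1) * (cχ (k + 1) + δ₂₉ (k + 1)) + 3 ^ (k + 1) * (cχ (k + 1) + δ₃₁ (k + 1))) / (k + 1)!
                  Err) : ℝ)
                    + (            ∑ k ∈ Finset.range t,
                    ((2 ^ (k + 1) * (2 ^ ((k + 1) * D) * 2 ^ 2 ^ ((k + 1) * D) * (max 1 (freeCov d α β 0 0)) ^ ((k + 1) * D)) *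
                    ((A * Real.exp (δ / 2 * ((D : ℝ) ^ 2 * d)) *
                        Real.exp (-((κ / 2 - δ / 2 * ((D : ℝ) ^ 2 * Real.sqrt d)) / 2 * w))) * nI *
                      ∑ p ∈ Finset.Icc 1 s, ((admissible p D).card : ℝ) *
                        ((2 / (1 - Real.exp (-((κ / 2 - δ / 2 * ((D : ℝ) ^ 2 * Real.sqrt d)) / 2 / (p : ℕ) / Real.sqrt d))) *
                          Real.exp ((κ / 2 - δ / 2 * ((D : ℝ) ^ 2 * Real.sqrt d)) / 2 / (p : ℕ) / Real.sqrt d)) ^ d) ^ (p - 1)) *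
                    (A * Real.exp (δ / 2 * ((D : ℝ) ^ 2 * d)) *
                      ((1 : ℝ) * (2 / (1 - Real.exp (-(δ / (2 * ((k + 1 : ℕ) : ℝ)) / Real.sqrt d))) * Real.exp (δ / (2 * ((k + 1 : ℕ) : ℝ)) / Real.sqrt d)) ^ d) *
                      ∑ p ∈ Finset.Icc 1 s, ((admissible p D).card : ℝ) *
                        ((2 / (1 - Real.exp (-((κ / 2 - δ / 2 * ((D : ℝ) ^ 2 * Real.sqrt d)) / (p : ℕ) / Real.sqrt d))) *
                          Real.exp ((κ / 2 - δ / 2 * ((D : ℝ) ^ 2 * Real.sqrt d)) / (p : ℕ) / Real.sqrt d)) ^ d) ^ (p - 1)) ^ k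
                    + 2 ^ (k + 1) * (2 ^ ((k + 1) * D) * 2 ^ 2 ^ ((k + 1) * D) * (max 1 (freeCov d α β 0 0)) ^ ((k + 1) * D)) *
                  (nI * (A * Real.exp (δ / 2 * ((D : ℝ) ^ 2 * d)) * Real.exp (-((κ / 2 - δ / 2 * ((D : ℝ) ^ 2 * Real.sqrt d)) / 2 * v)) *
                    (L : ℝ) ^ d * ∑ p ∈ Finset.Icc 1 s, ((admissible p D).card : ℝ) *
                        ((2 / (1 - Real.exp (-((κ / 2 - δ / 2 * ((D : ℝ) ^ 2 * Real.sqrt d)) / 2 / (p : ℕ) / Real.sqrt d))) *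
                          Real.exp ((κ / 2 - δ / 2 * ((D : ℝ) ^ 2 * Real.sqrt d)) / 2 / (p : ℕ) / Real.sqrt d)) ^ d) ^ (p - 1))) *
                  (A * Real.exp (δ / 2 * ((D : ℝ) ^ 2 * d)) *
                    (2 / (1 - Real.exp (-(δ / (2 * ((k + 1 : ℕ) : ℝ)) / Real.sqrt d))) * Real.exp (δ / (2 * ((k + 1 : ℕ) : ℝ)) / Real.sqrt d)) ^ d *
                    ∑ p ∈ Finset.Icc 1 s, ((admissible p D).card : ℝ) *
                        ((2 / (1 - Real.exp (-((κ / 2 - δ / 2 * ((D : ℝ) ^ 2 * Real.sqrt d)) / (p : ℕ) / Real.sqrt d))) *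
                          Real.exp ((κ / 2 - δ / 2 * ((D : ℝ) ^ 2 * Real.sqrt d)) / (p : ℕ) / Real.sqrt d)) ^ d) ^ (p - 1)) ^ k)
                    + (2 ^ (k + 1) * (2 ^ ((k + 1) * D) * 2 ^ 2 ^ ((k + 1) * D) * (max 1 (freeCov d α β 0 0)) ^ ((k + 1) * D)) *
                    (A * Real.exp (δ / 2 * ((D : ℝ) ^ 2 * d)) * Real.exp (-((κ / 2 - δ / 2 * ((D : ℝ) ^ 2 * Real.sqrt d)) / 2 * w)) *
                      (nI * (L : ℝ) ^ d) * ∑ p ∈ Finset.Icc 1 s, ((admissible p D).card : ℝ) *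
                        ((2 / (1 - Real.exp (-((κ / 2 - δ / 2 * ((D : ℝ) ^ 2 * Real.sqrt d)) / 2 / (p : ℕ) / Real.sqrt d))) *
                          Real.exp ((κ / 2 - δ / 2 * ((D : ℝ) ^ 2 * Real.sqrt d)) / 2 / (p : ℕ) / Real.sqrt d)) ^ d) ^ (p - 1)) *
                    (A * Real.exp (δ / 2 * ((D : ℝ) ^ 2 * d)) *
                      (2 / (1 - Real.exp (-(δ / (2 * ((k + 1 : ℕ) : ℝ)) / Real.sqrt d))) * Real.exp (δ / (2 * ((k + 1 : ℕ) : ℝ)) / Real.sqrt d)) ^ d *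
                      ∑ p ∈ Finset.Icc 1 s, ((admissible p D).card : ℝ) *
                        ((2 / (1 - Real.exp (-((κ / 2 - δ / 2 * ((D : ℝ) ^ 2 * Real.sqrt d)) / (p : ℕ) / Real.sqrt d))) *
                          Real.exp ((κ / 2 - δ / 2 * ((D : ℝ) ^ 2 * Real.sqrt d)) / (p : ℕ) / Real.sqrt d)) ^ d) ^ (p - 1)) ^ k
                    + 2 ^ (k + 1) * (2 ^ ((k + 1) * D) * 2 ^ 2 ^ ((k + 1) * D) * (max 1 (freeCov d α β 0 0)) ^ ((k + 1) * D)) *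
                  (nI * (A * Real.exp (δ / 2 * ((D : ℝ) ^ 2 * d)) * Real.exp (-((κ / 2 - δ / 2 * ((D : ℝ) ^ 2 * Real.sqrt d)) / 2 * v)) *
                    (L : ℝ) ^ d * ∑ p ∈ Finset.Icc 1 s, ((admissible p D).card : ℝ) *
                        ((2 / (1 - Real.exp (-((κ / 2 - δ / 2 * ((D : ℝ) ^ 2 * Real.sqrt d)) / 2 / (p : ℕ) / Real.sqrt d))) *
                          Real.exp ((κ / 2 - δ / 2 * ((D : ℝ) ^ 2 * Real.sqrt d)) / 2 / (p : ℕ) / Real.sqrt d)) ^ d) ^ (p - 1))) *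
                  (A * Real.exp (δ / 2 * ((D : ℝ) ^ 2 * d)) *
                    (2 / (1 - Real.exp (-(δ / (2 * ((k + 1 : ℕ) : ℝ)) / Real.sqrt d))) * Real.exp (δ / (2 * ((k + 1 : ℕ) : ℝ)) / Real.sqrt d)) ^ d *
                    ∑ p ∈ Finset.Icc 1 s, ((admissible p D).card : ℝ) *
                        ((2 / (1 - Real.exp (-((κ / 2 - δ / 2 * ((D : ℝ) ^ 2 * Real.sqrt d)) / (p : ℕ) / Real.sqrt d))) *
                          Real.exp ((κ / 2 - δ / 2 * ((D : ℝ) ^ 2 * Real.sqrt d)) / (p : ℕ) / Real.sqrt d)) ^ d) ^ (p - 1)) ^ k)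
                    + 2 ^ ((k + 1) * D) * 2 ^ 2 ^ ((k + 1) * D) * (max 1 (freeCov d α β 0 0)) ^ ((k + 1) * D) *
                  (nI * (((k + 1 : ℕ) : ℝ) * (k : ℝ) *
                    ((A * Real.exp (δ / 2 * ((D : ℝ) ^ 2 * d)) * ((L : ℝ) ^ d * (2 / (1 - Real.exp (-(δ / (2 * ((k + 1 : ℕ) : ℝ)) / Real.sqrt d))) * Real.exp (δ / (2 * ((k + 1 : ℕ) : ℝ)) / Real.sqrt d)) ^ d) *
                        ∑ p ∈ Finset.Icc 1 s, ((admissible p D).card : ℝ) *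
                        ((2 / (1 - Real.exp (-((κ / 2 - δ / 2 * ((D : ℝ) ^ 2 * Real.sqrt d)) / (p : ℕ) / Real.sqrt d))) *
                          Real.exp ((κ / 2 - δ / 2 * ((D : ℝ) ^ 2 * Real.sqrt d)) / (p : ℕ) / Real.sqrt d)) ^ d) ^ (p - 1)) * ((A * Real.exp (δ / 2 * ((D : ℝ) ^ 2 * d)) * Real.exp (-(δ / (2 * ((k + 1 : ℕ) : ℝ)) / 2 * ((w : ℝ) + v + 1))) * ((L : ℝ) ^ d * (2 / (1 - Real.exp (-(δ / (2 * ((k + 1 : ℕ) : ℝ)) / 2 / Real.sqrt d))) * Real.exp (δ / (2 * ((k + 1 : ℕ) : ℝ)) / 2 / Real.sqrt d)) ^ d) *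
                        ∑ p ∈ Finset.Icc 1 s, ((admissible p D).card : ℝ) *
                        ((2 / (1 - Real.exp (-((κ / 2 - δ / 2 * ((D : ℝ) ^ 2 * Real.sqrt d)) / (p : ℕ) / Real.sqrt d))) *
                          Real.exp ((κ / 2 - δ / 2 * ((D : ℝ) ^ 2 * Real.sqrt d)) / (p : ℕ) / Real.sqrt d)) ^ d) ^ (p - 1)) *
                       (A * Real.exp (δ / 2 * ((D : ℝ) ^ 2 * d)) * ((L : ℝ) ^ d * (2 / (1 - Real.exp (-(δ / (2 * ((k + 1 : ℕ) : ℝ)) / Real.sqrt d))) * Real.exp (δ / (2 * ((k + 1 : ℕ) : ℝ)) / Real.sqrt d)) ^ d) *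
                        ∑ p ∈ Finset.Icc 1 s, ((admissible p D).card : ℝ) *
                        ((2 / (1 - Real.exp (-((κ / 2 - δ / 2 * ((D : ℝ) ^ 2 * Real.sqrt d)) / (p : ℕ) / Real.sqrt d))) *
                          Real.exp ((κ / 2 - δ / 2 * ((D : ℝ) ^ 2 * Real.sqrt d)) / (p : ℕ) / Real.sqrt d)) ^ d) ^ (p - 1)) ^ (k - 1)))))
                    + nI * ((3 : ℝ) ^ (k + 1) *
                  (2 ^ ((k + 1) * D) * 2 ^ 2 ^ ((k + 1) * D) * (max 1 (freeCov d α β 0 0)) ^ ((k + 1) * D) *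
                      Real.exp (-(δ / 2 * ((v : ℝ) + 1))) *
                    (A * Real.exp (δ / 2 * ((D : ℝ) ^ 2 * d)) * (L : ℝ) ^ d * ∑ p ∈ Finset.Icc 1 s, ((admissible p D).card : ℝ) *
                        ((2 / (1 - Real.exp (-((κ / 2 - δ / 2 * ((D : ℝ) ^ 2 * Real.sqrt d)) / (p : ℕ) / Real.sqrt d))) *
                          Real.exp ((κ / 2 - δ / 2 * ((D : ℝ) ^ 2 * Real.sqrt d)) / (p : ℕ) / Real.sqrt d)) ^ d) ^ (p - 1)) ^ (k + 1)))) / (k + 1)! : ℝ)))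
                ≤ nI * errTerm S ρ₁ ρ₂ ρ₃ ρ₄ A b t)) :
    ∃ bstar : ℝ, ∀ (t D : ℕ) (ϰ : ℝ), 0 < ϰ → ∃ S ρ₁ ρ₂ ρ₃ ρ₄ : ℝ, 0 ≤ S ∧ 0 < ρ₃ ∧
      ∀ (s : ℕ) (b : ℝ), bstar < b → ∀ (I J : Finset (Fin d → ℤ)), I.Nonempty → J ⊆ I → ∀ a : Coef d,
        (∀ (C : Finset (Fin d → ℤ)) (zbar : (Fin d → ℤ) → ℝ), (∀ x ∈ C, ∀ y ∈ J, b ^ 3 ≤ cubeDist x y) →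
            Ineq46 d α β t D s ϰ S ρ₁ ρ₂ ρ₃ ρ₄ b I J C a zbar) ∧
          Ineq47 d α β t D s ϰ S ρ₁ ρ₂ ρ₃ ρ₄ b I J a := by
  obtain ⟨bstar, hmain⟩ := hboth 2 (4 * 8 ^ d) (1 / 2) (by positivity) (by norm_num)
  refine ⟨bstar, fun t D ϰ hϰ => ?_⟩
  obtain ⟨ρ₁, ρ₂, ρ₃, ρ₄, hρ₃, ⟨S₁, δ₁, hS₁, hδ₁, hδ₁le, hres₁, hlow⟩, ⟨S₂, δ₂, hS₂, hδ₂, hδ₂le, hres₂, hup⟩⟩ :=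
    hmain t D ϰ hϰ
  refine ⟨max S₁ S₂, ρ₁, ρ₂, ρ₃, ρ₄, le_max_of_le_left hS₁, hρ₃, fun s b hb I J hI hJI a => ⟨fun C zbar hfar => ?_, ?_⟩⟩
  · -- (4.6): the upper package at this `b`
    obtain ⟨L, w, v, hL2, hfit, hv, hw, hb1, hsmall, hR, hled⟩ := hup b hb
    have hI1 : (1 : ℝ) ≤ (I.card : ℝ) := by exact_mod_cast Finset.card_pos.mpr hI
    have hA0 : 0 ≤ coefSup s D a J := coefSup_nonneg s D a J
    have hb0 : 0 ≤ b := by linarith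
    have hmono : (I.card : ℝ) * errTerm S₂ ρ₁ ρ₂ ρ₃ ρ₄ (coefSup s D a J) b t ≤
        (I.card : ℝ) * errTerm (max S₁ S₂) ρ₁ ρ₂ ρ₃ ρ₄ (coefSup s D a J) b t :=
      mul_le_mul_of_nonneg_left (errTerm_mono (le_max_right _ _) hA0 hb0) (by positivity)
    exact ineq46_of_ledger hα hβ hvar hd hϰ hJI a rfl hL2 hfit hv hw hγ0 hγ1 hγc hb1 hsmall hδ₂ hδ₂le hres₂ t zbar hfar hR
      ((hled s (I.card : ℝ) (coefSup s D a J) hI1 hA0).trans hmono)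
  · -- (4.7): the lower package at this `b`, Appendix A at `(2, 4·8^d, ½)`
    obtain ⟨L, w, v, hL2, hfit, hv, hw, hb1, hsmall, hbbar, hled⟩ := hlow b hb
    have hI1 : (1 : ℝ) ≤ (I.card : ℝ) := by exact_mod_cast Finset.card_pos.mpr hI
    have hA0 : 0 ≤ coefSup s D a J := coefSup_nonneg s D a J
    have hb0 : 0 ≤ b := by
      by_contra h
      have h' : γ ^ (d + 1) * b ≤ 0 := mul_nonpos_of_nonneg_of_nonpos (pow_pos hγ0 _).le (le_of_lt (not_le.mp h))
      linarith
    have hmono : (I.card : ℝ) * errTerm S₁ ρ₁ ρ₂ ρ₃ ρ₄ (coefSup s D a J) b t ≤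
        (I.card : ℝ) * errTerm (max S₁ S₂) ρ₁ ρ₂ ρ₃ ρ₄ (coefSup s D a J) b t :=
      mul_le_mul_of_nonneg_left (errTerm_mono (le_max_left _ _) hA0 hb0) (by positivity)
    exact ineq47_of_ledger hα hβ hvar hd hϰ hJI hI a rfl hL2 hfit hv hw hγ0.le hγ1 hγc hb1 hsmall hδ₁ hδ₁le hres₁ t
      (appendixA_at_two hα hβ (hvar.trans (by norm_num))) hbbar ((hled s (I.card : ℝ) (coefSup s D a J) hI1 hA0).trans hmono)

end Knit

end Literature.MathematicalPhysics.QuantumFieldTheory.Balaban1983to89.B1Eq324BenfattoSect5BasicLemmaKnit
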